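import Summits.BirchSwinnertonDyer.BirchSwinnertonDyer.Theorems.ByReductionTypeAtTwoGoodOrdTowerControlKummerFixed
import Summits.BirchSwinnertonDyer.BirchSwinnertonDyer.Theorems.ByReductionTypeAtTwoGoodOrdTowerControlLayerEP
import Summits.BirchSwinnertonDyer.BirchSwinnertonDyer.Theorems.ByReductionTypeAtTwoGoodOrdTowerEPTower
import Summits.BirchSwinnertonDyer.BirchSwinnertonDyer.Theorems.ByReductionTypeAtTwoMultTowerNS2LocalLayerIndex
import Literature.NumberTheory.GaloisRepresentations.KummerIdeleIndex
import Summits.BirchSwinnertonDyer.BirchSwinnertonDyer.Theorems.ByReductionTypeAtTwoGoodOrdTowerControlDualBound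
import Summits.BirchSwinnertonDyer.BirchSwinnertonDyer.Theorems.ByReductionTypeAtTwoGoodOrdTowerControlDualCount
import Summits.BirchSwinnertonDyer.BirchSwinnertonDyer.Theorems.ByReductionTypeAtTwoGoodOrdTowerControlLutzPow
import Summits.BirchSwinnertonDyer.BirchSwinnertonDyer.Theorems.ByReductionTypeAtTwoGoodOrdTowerLayerLutz
import Summits.BirchSwinnertonDyer.BirchSwinnertonDyer.Theorems.ByReductionTypeAtTwoMultTowerNS2LocalLayerField
import Literature.NumberTheory.EllipticCurves.OrdinaryLocalKummerCountProofs
import Literature.NumberTheory.GaloisRepresentations.LocalFieldCdTwo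
import Literature.NumberTheory.Automorphic.AdicCompletionLocalField
import HarnessLib

/-!
# Route `ByReductionTypeAtTwo`, item `OrdKatoHalfAtTwo` (stmt-BirchSwinnertonDyer-19271), TOWER road, the
# GOOD-ORDINARY local tower kernels at `v ∣ p`, ANY prime `p`, CONDITIONAL on Tate's local Euler–Poincaré formula: the
# FORMAL-GROUP COUNT at depth `p^k` — `#(Ê(𝔪̄)^{H_∞}/(g − 1))[p^k] ≤ #SF`, uniformly in the layer `n` and the depth `k`

HONEST FRAMING (cell `bsd-2adic`, run/shared/lean/pub/bsd-2adic/, seat `bsd-2adic-tower-1` GEN 20, HUMAN RULINGS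
D-0036 / D-0054 / D-0074): TOOL theorem only (no definition, no named fact, no `sorry`); closes nothing by itself;
nothing booked; BSD is not proved by any of this. The central assembly step of the programme «UNIFORM layer bound
`∃ C, ∀ n, #𝒦_{v,n}[2^∞] ≤ C` at a good ordinary `2` over `ℚ`» ⇒ `WeierstrassCurve.Greenberg1999_kerG_bounded` at `p = 2`
⇒ Mazur's control theorem `WeierstrassCurve.selmer_control` over `ℚ` at `p = 2` (Greenberg, LNM 1716, Thm. 1.2): with
`A₁ = ker red₀ = Ê(𝔪̄)` (the formal group of good reduction inside `E(K̄_v)`), `M₁ = A₁^{H_∞}`, `D₁ = g − 1` for a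
topological generator `g` of `H_n` over `H_∞`, and `SF ⊇ {red₀ Q : red₀(τ Q) = red₀ Q}` the finite Frobenius-fixed part of
the reduction (`τ ∈ H_∞` a Frobenius fixing `μ_{2^∞}`): **`#(M₁/D₁ M₁)[2^k] ≤ #SF` for every `n`, `k`** — the bound does not
depend on `n` or `k`. Chain: Kummer at depth `2^k` (BRICK B2′ `natCard_torsionBy_coinv_mul_card_quotient_le_card_H1_of_fixed`:
`#(M₁/D₁M₁)[2^k] · #(A₁^{H_n}/2^k) ≤ #H¹(H_n, Ê[2^k])`), the Euler–Poincaré count of the CYCLIC `2`-power module `Ê[2^k]`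
over `H_n` (BRICKS C, C′: `#H¹ = 2^{k 2^n} · #Ê[2^k]^{H_n} · #H²`), local duality for `H²` (BRICKS D, D2 and the layer-`0`
file's `card_filter_smul_nsmul_eq_le`: `#H²(H_n, Ê[2^k]) ≤ #SF`), and Lutz at depth `2^k` (BRICK E with G6c:
`#(A₁^{H_n}/2^k) = 2^{k 2^n} · #A₁^{H_n}[2^k]`); the factors `2^{k 2^n} · #A₁^{H_n}[2^k]` cancel.

* `natCard_torsionBy_coinv_formal_le_of_localEP` — the all-`p` inequality, hypotheses in the abstract `red₀`-form of GEN 11's bricks,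
  CONDITIONAL on the named fact `localEulerPoincareCharacteristic ℚ_v` (Tate, Milne ADT I Thm. 2.8) which replaces BRICKS C/C′
  (at `p = 2` the unconditional `natCard_torsionBy_coinv_formal_le` of `…ControlLayerFormal.lean`).

References: R. Greenberg, LNM 1716 (1999), §2 Props. 2.2, 2.5, §3 Lemma 3.4; J. Milne, *ADT* (2006), I Thm. 2.8, Cor. 2.3,
Lemma 3.3; J.-P. Serre, *Galois Cohomology* (1997), I §2.5, II §5.
-/

set_option autoImplicit false
-- the Theorems namespace of this sub repeats the summit name by design (D-0017 nested layout: Summit.<S>.<Sub>)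
set_option linter.dupNamespace false

noncomputable section

open scoped Classical NNReal

namespace Summit.BirchSwinnertonDyer.BirchSwinnertonDyer.Theorems.GoodOrdTower

open CategoryTheory NumberField IsDedekindDomain Field
  Literature.NumberTheory.GaloisRepresentations Literature.NumberTheory.GaloisRepresentations.DiscreteGaloisModule
  IsDedekindDomain.HeightOneSpectrum Literature.NumberTheory.EllipticCurves.FormalGroupChart
  _root_.TopRep _root_.ContRepresentation _root_.ContinuousCohomology WeierstrassCurve
open Literature.NumberTheory.EllipticCurves hiding subgroupIncl

variable {p : ℕ} [hp : Fact p.Prime] {κ : ZpExtension ℚ p}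

/-- `#(𝒪[ℚ_v] ⧸ m) = #(ℤ_v ⧸ m)` for `m : ℕ`, the two valuation rings having the same elements (copy of the private helper
of `LocalEulerCharacteristicMu` / `…GoodOrdTowerEPTower`). [folklore] -/
private theorem natCard_integer_quotient_natCast_eq'' (v : HeightOneSpectrum (𝓞 ℚ)) (m : ℕ) :
    Nat.card ((ValuativeRel.valuation (v.adicCompletion ℚ)).integer ⧸
        Ideal.span {((m : ℕ) : (ValuativeRel.valuation (v.adicCompletion ℚ)).integer)}) =
      Nat.card (Valued.integer (v.adicCompletion ℚ) ⧸
        Ideal.span {((m : ℕ) : Valued.integer (v.adicCompletion ℚ))}) := by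
  have hO : (ValuativeRel.valuation (v.adicCompletion ℚ)).integer = Valued.integer (v.adicCompletion ℚ) := by
    ext x
    rw [Valuation.mem_integer_iff, adicCompletion_valuation_le_one_iff ℚ v x,
      Valuation.mem_integer_iff, Valued.toNormedField.norm_le_one_iff]
  let e : (ValuativeRel.valuation (v.adicCompletion ℚ)).integer ≃+* Valued.integer (v.adicCompletion ℚ) :=
    RingEquiv.subringCongr hO
  have hIJ : Ideal.span {((m : ℕ) : Valued.integer (v.adicCompletion ℚ))} =
      (Ideal.span {((m : ℕ) : (ValuativeRel.valuation (v.adicCompletion ℚ)).integer)}).map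
        (e : (ValuativeRel.valuation (v.adicCompletion ℚ)).integer →+* _) := by
    rw [Ideal.map_span, Set.image_singleton, map_natCast]
  exact Nat.card_congr (Ideal.quotientEquiv _ _ e hIJ).toEquiv

set_option maxHeartbeats 3200000 in
/-- **The formal-group count at depth `2^k`, uniformly in the layer: `#(Ê(𝔪̄)^{H_∞}/(g − 1))[2^k] ≤ #SF`.** Setting: `κ`
the cyclotomic `ℤ₂`-extension of `ℚ`, `v ∣ 2`, `K = ℚ_v`, `w` the spectral valuation on `K̄_v`, `W/ℚ` with `W ⊗ K̄_v`
integral and elliptic, `red₀ : E(K̄_v) → B` an additive «reduction» with kernel the formal group `E₁(K̄_v)` of `w` (`hker`),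
`Γ`-stable kernel (`hstab`), `2`-divisible kernel (`hdiv₁`), ordinary filtration (`hgenr`: `ker red₀ ∩ E[2^r]` cyclic of
order `2^r` on a generator; `hsurj`: `red₀(E[2^r]) = B[2^r]`), `τ ∈ H_∞` fixing every `2`-power root of unity with the
reductions fixed by `τ` in the finite set `SF`, `g ∈ H_n` a topological generator over `H_∞`, `M₁ = ker red₀ ∩ E(K̄_v)^{H_∞}`,
`D₁ = g − 1`. Then for every `k` the `2^k`-torsion of `M₁/D₁M₁` is finite with at most `#SF` elements. See the module
docstring for the chain of bricks. [cite: GreenbergLNM1716, §2 Prop. 2.5, §3 Lemma 3.4 (p. 89)]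
[cite: MilneADT2006, I Thm. 2.8, Cor. 2.3] -/
theorem natCard_torsionBy_coinv_formal_le_of_localEP (hκ : κ.IsCyclotomic) (v : HeightOneSpectrum (𝓞 ℚ))
    (hv : ((p : ℕ) : 𝓞 ℚ) ∈ v.asIdeal) (hEP : localEulerPoincareCharacteristic (v.adicCompletion ℚ))
    (W : WeierstrassCurve ℚ) [W.IsElliptic] (n k : ℕ)
    {w : Valuation (AlgebraicClosure (v.adicCompletion ℚ)) ℝ≥0}
    (hw : ∀ x, (w x : ℝ) = spectralNorm (v.adicCompletion ℚ) (AlgebraicClosure (v.adicCompletion ℚ)) x)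
    [hV : (W.baseChange (AlgebraicClosure (v.adicCompletion ℚ))).IsIntegral w.integer]
    [(W.baseChange (AlgebraicClosure (v.adicCompletion ℚ))).IsElliptic]
    [hVL : (W.baseChange (IntermediateField.fixedField
        (localSubgroup (κ.layerSubgroup n) (v.adicCompletion ℚ)) :
          IntermediateField (v.adicCompletion ℚ) (AlgebraicClosure (v.adicCompletion ℚ)))).IsIntegral
      (w.comap (algebraMap (IntermediateField.fixedField
        (localSubgroup (κ.layerSubgroup n) (v.adicCompletion ℚ)) :
          IntermediateField (v.adicCompletion ℚ) (AlgebraicClosure (v.adicCompletion ℚ)))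
        (AlgebraicClosure (v.adicCompletion ℚ)))).integer]
    {B : Type} [AddCommGroup B] (red₀ : localPoints W (v.adicCompletion ℚ) →+ B)
    (hker : ∀ Q : localPoints W (v.adicCompletion ℚ), red₀ Q = 0 ↔
      (Q : (W.baseChange (AlgebraicClosure (v.adicCompletion ℚ))).toAffine.Point) ∈
        kernel w (W.baseChange (AlgebraicClosure (v.adicCompletion ℚ))))
    (hstab : ∀ (σ : absoluteGaloisGroup (v.adicCompletion ℚ)) (Q : localPoints W (v.adicCompletion ℚ)),
      red₀ Q = 0 → red₀ (σ • Q) = 0)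
    (hdiv₁ : ∀ a : localPoints W (v.adicCompletion ℚ), red₀ a = 0 →
      ∃ b : localPoints W (v.adicCompletion ℚ), red₀ b = 0 ∧ p • b = a)
    (hgenr : ∀ r : ℕ, ∃ P₁ : localPoints W (v.adicCompletion ℚ), red₀ P₁ = 0 ∧ addOrderOf P₁ = p ^ r ∧
      ∀ P : localPoints W (v.adicCompletion ℚ), red₀ P = 0 → ((p ^ r : ℕ) : ℤ) • P = 0 → ∃ c : ℕ, P = c • P₁)
    (hsurj : ∀ (r : ℕ) (y : B), ((p ^ r : ℕ) : ℤ) • y = 0 →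
      ∃ x : localPoints W (v.adicCompletion ℚ), ((p ^ r : ℕ) : ℤ) • x = 0 ∧ red₀ x = y)
    {τ : absoluteGaloisGroup (v.adicCompletion ℚ)}
    (hτHi : τ ∈ localSubgroup κ.kerSubgroup (v.adicCompletion ℚ))
    (hτfix : ∀ (r : ℕ) (ξ : AlgebraicClosure (v.adicCompletion ℚ)), ξ ^ p ^ r = 1 → τ • ξ = ξ)
    (SF : Finset B) (hSF : ∀ Q : localPoints W (v.adicCompletion ℚ), red₀ (τ • Q) = red₀ Q → red₀ Q ∈ SF)
    {g : absoluteGaloisGroup (v.adicCompletion ℚ)}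
    (hg : g ∈ localSubgroup (κ.layerSubgroup n) (v.adicCompletion ℚ))
    (hgen : ∀ U : Subgroup (absoluteGaloisGroup (v.adicCompletion ℚ)),
      IsOpen (U : Set (absoluteGaloisGroup (v.adicCompletion ℚ))) →
        localSubgroup κ.kerSubgroup (v.adicCompletion ℚ) ≤ U → g ∈ U →
          localSubgroup (κ.layerSubgroup n) (v.adicCompletion ℚ) ≤ U)
    (M₁ : AddSubgroup (localPoints W (v.adicCompletion ℚ)))
    (hM₁ : ∀ a, a ∈ M₁ ↔ a ∈ red₀.ker ∧ ∀ h ∈ localSubgroup κ.kerSubgroup (v.adicCompletion ℚ), h • a = a)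
    (D₁ : M₁ →+ M₁) (hD₁ : ∀ a : M₁, ((D₁ a : M₁) : localPoints W (v.adicCompletion ℚ)) = g • (a : _) - a) :
    Finite {c : M₁ ⧸ D₁.range // p ^ k • c = 0} ∧
      Nat.card {c : M₁ ⧸ D₁.range // p ^ k • c = 0} ≤ SF.card := by
  -- notation
  let K := v.adicCompletion ℚ
  let P : Type := localPoints W K
  let Γ := absoluteGaloisGroup K
  let Hn : Subgroup Γ := localSubgroup (κ.layerSubgroup n) K
  let Hi : Subgroup Γ := localSubgroup κ.kerSubgroup K
  haveI : CompactSpace Γ := absoluteGaloisGroup_compactSpace K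
  have hkst : ∀ (σ : Γ) (a : P), a ∈ red₀.ker → σ • a ∈ red₀.ker :=
    fun σ a ha ↦ (AddMonoidHom.mem_ker).mpr (hstab σ a ((AddMonoidHom.mem_ker).mp ha))
  have hHile : Hi ≤ Hn := localSubgroup_ker_le_layer κ K n
  have hopen : IsOpen (Hn : Set Γ) := MultTowerNS2.isOpen_localSubgroup _ (κ.isOpen_layerSubgroup n) K
  have hclosed : IsClosed (Hn : Set Γ) := Subgroup.isClosed_of_isOpen _ hopen
  haveI hHnN : Hn.Normal := by
    change (localSubgroup (κ.layerSubgroup n) K).Normal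
    rw [localSubgroup_eq_comap]; exact Subgroup.Normal.comap inferInstance _
  haveI : CompactSpace Hn := isCompact_iff_compactSpace.mp hclosed.isCompact
  -- `Aₙ = A₁ ∩ E(K̄_v)^{H_n}`
  let Aₙ : AddSubgroup P := red₀.ker ⊓ FixedPoints.addSubgroup Hn P
  have hAₙ : ∀ a, a ∈ Aₙ ↔ a ∈ red₀.ker ∧ ∀ σ ∈ Hn, σ • a = a := fun a ↦ by
    change a ∈ red₀.ker ⊓ FixedPoints.addSubgroup Hn P ↔ _
    rw [AddSubgroup.mem_inf, FixedPoints.mem_addSubgroup]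
    exact ⟨fun ⟨h1, h2⟩ ↦ ⟨h1, fun σ hσ ↦ h2 ⟨σ, hσ⟩⟩, fun ⟨h1, h2⟩ ↦ ⟨h1, fun σ ↦ h2 σ σ.2⟩⟩
  -- iterated `p`-divisibility of `A₁`
  have hdivpow : ∀ (j : ℕ) (a : P), a ∈ red₀.ker → ∃ b ∈ red₀.ker, p ^ j • b = a := by
    intro j
    induction j with
    | zero => exact fun a ha ↦ ⟨a, ha, by rw [pow_zero, one_smul]⟩
    | succ j ih =>
      intro a ha
      obtain ⟨b, hb, rfl⟩ := hdiv₁ a ((AddMonoidHom.mem_ker).mp ha)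
      obtain ⟨c, hc, rfl⟩ := ih b ((AddMonoidHom.mem_ker).mpr hb)
      exact ⟨c, hc, by rw [pow_succ, mul_comm, mul_smul]⟩
  -- the torsion module `Z = A₁[p^k]`, cyclic on `P_k`
  obtain ⟨Pk, hPk0, hPkord, hPkgen⟩ := hgenr k
  have hPk2 : p ^ k • Pk = 0 := by rw [← hPkord]; exact addOrderOf_nsmul_eq_zero Pk
  let Zs : AddSubgroup P := red₀.ker ⊓ AddSubgroup.torsionBy P ((p ^ k : ℕ) : ℤ)
  have hZs : ∀ a : P, a ∈ Zs ↔ red₀ a = 0 ∧ p ^ k • a = 0 := fun a ↦ by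
    change a ∈ red₀.ker ⊓ AddSubgroup.torsionBy P ((p ^ k : ℕ) : ℤ) ↔ _
    rw [AddSubgroup.mem_inf, AddMonoidHom.mem_ker]
    exact and_congr Iff.rfl AddSubgroup.torsionBy.nsmul_iff
  have hPkZ : Pk ∈ Zs := (hZs Pk).mpr ⟨hPk0, hPk2⟩
  have hZmul : ∀ a ∈ Zs, ∃ c : ℕ, a = c • Pk := fun a ha ↦
    hPkgen a ((hZs a).mp ha).1 (by rw [natCast_zsmul]; exact ((hZs a).mp ha).2)
  have hZstab : ∀ (σ : Γ) (a : P), a ∈ Zs → σ • a ∈ Zs := fun σ a ha ↦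
    (hZs _).mpr ⟨hstab σ a ((hZs a).mp ha).1, by rw [smul_comm, ((hZs a).mp ha).2, smul_zero]⟩
  -- the `Γ`-action on `Z`
  letI iSMul : SMul Γ Zs := ⟨fun σ z ↦ ⟨σ • (z : P), hZstab σ z z.2⟩⟩
  have hsmul : ∀ (σ : Γ) (z : Zs), ((σ • z : Zs) : P) = σ • (z : P) := fun _ _ ↦ rfl
  letI iMA : MulAction Γ Zs :=
    { one_smul := fun z ↦ Subtype.ext (by rw [hsmul, one_smul])
      mul_smul := fun σ σ' z ↦ Subtype.ext (by rw [hsmul, hsmul, hsmul, mul_smul]) }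
  letI iDMA : DistribMulAction Γ Zs :=
    { smul_zero := fun σ ↦ Subtype.ext (by rw [hsmul, ZeroMemClass.coe_zero, smul_zero])
      smul_add := fun σ z z' ↦ Subtype.ext (by
        rw [hsmul, AddMemClass.coe_add, AddMemClass.coe_add, hsmul, hsmul, smul_add]) }
  let ρC : ContinuousRep Γ ℤ Zs :=
    ContinuousRep.ofStabilizerMemNhdsOne (Representation.ofDistribMulAction ℤ Γ Zs) fun z ↦ by
      have hopen' : IsOpen ((fun σ : Γ ↦ σ • (z : P)) ⁻¹' {(z : P)}) :=
        (isOpen_discrete _).preimage (continuous_smul_localPoints W K (z : P))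
      refine Filter.mem_of_superset (hopen'.mem_nhds (by simp)) fun σ hσ ↦ ?_
      exact Subtype.ext hσ
  have hρC : ∀ (σ : Γ) (z : Zs), ((ρC σ z : Zs) : P) = σ • (z : P) := fun _ _ ↦ rfl
  -- `Z` is cyclic of order `2^k`
  let Pz : Zs := ⟨Pk, hPkZ⟩
  have hZgen : ∀ z : Zs, ∃ i : ℕ, z = i • Pz := fun z ↦ by
    obtain ⟨c, hc⟩ := hZmul z z.2
    exact ⟨c, Subtype.ext (by rw [AddSubmonoidClass.coe_nsmul]; exact hc)⟩
  have hPzord : addOrderOf Pz = p ^ k := by rw [← AddSubgroup.addOrderOf_coe Pz]; exact hPkord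
  have hZcard : Nat.card Zs = p ^ k := by
    have h : (AddSubgroup.zmultiples Pz : AddSubgroup Zs) = ⊤ := by
      rw [eq_top_iff]
      intro z _
      obtain ⟨i, hi⟩ := hZgen z
      exact hi ▸ AddSubgroup.nsmul_mem _ (AddSubgroup.mem_zmultiples Pz) i
    rw [← hPzord, ← Nat.card_zmultiples Pz, h, AddSubgroup.card_top]
  haveI hZfin : Finite Zs := Nat.finite_of_card_ne_zero (by rw [hZcard]; exact pow_ne_zero k hp.out.ne_zero)
  haveI hZcyc : IsAddCyclic Zs :=
    ⟨⟨Pz, fun z ↦ by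
      obtain ⟨i, hi⟩ := hZgen z
      exact ⟨(i : ℤ), by change (i : ℤ) • Pz = z; rw [natCast_zsmul, hi]⟩⟩⟩
  have hZ2k : ∀ z : Zs, p ^ k • z = 0 := fun z ↦ Subtype.ext (by
    rw [AddSubmonoidClass.coe_nsmul, ZeroMemClass.coe_zero]; exact ((hZs z).mp z.2).2)
  -- BRICK F: the Euler–Poincaré count of `Z` over `H_n` from Tate's formula (named fact) by Shapiro
  have hZprim : IsPrimaryTorsion p Zs := fun z ↦ ⟨k, hZ2k z⟩
  obtain ⟨hf1, hf2, m, hmle, hEPZ⟩ : Finite (continuousCohomology 1 (ρC.restrict (subgroupIncl Hn)).toTopRep) ∧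
      Finite (continuousCohomology 2 (ρC.restrict (subgroupIncl Hn)).toTopRep) ∧
      ∃ m : ℕ, p ^ m ≤ Nat.card Zs ^ Hn.index ∧
        Nat.card (continuousCohomology 1 (ρC.restrict (subgroupIncl Hn)).toTopRep) =
          Nat.card (ρC.restrict (subgroupIncl Hn)).toTopRep.ρ.invariants *
            Nat.card (continuousCohomology 2 (ρC.restrict (subgroupIncl Hn)).toTopRep) *
            Nat.card ((ValuativeRel.valuation K).integer ⧸ Ideal.span {((p ^ m : ℕ) : (ValuativeRel.valuation K).integer)}) := by
    haveI : CharZero K := charZero_of_injective_algebraMap (algebraMap ℚ K).injective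
    exact natCard_one_restrict_le_of_localEP K hEP Hn hopen ρC hZprim
  haveI := hf1
  haveI := hf2
  -- `#(𝒪[ℚ_v] ⧸ p^m) = p^m ≤ p^{k p^n}`
  have hidx := MultTowerNS2.index_localSubgroup_layerSubgroup hκ v hv n
  rw [hZcard, hidx, ← pow_mul] at hmle
  have hOm : Nat.card ((ValuativeRel.valuation K).integer ⧸ Ideal.span {((p ^ m : ℕ) : (ValuativeRel.valuation K).integer)}) = p ^ m := by
    rw [natCard_integer_quotient_natCast_eq'' v (p ^ m)]
    have hT : ∀ v' : HeightOneSpectrum (𝓞 ℚ), ((p ^ m : ℕ) : 𝓞 ℚ) ∈ v'.asIdeal → v' ∈ ({v} : Finset _) := by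
      intro v' hv'
      rw [Finset.mem_singleton]
      have hv'p : ((p : ℕ) : 𝓞 ℚ) ∈ v'.asIdeal := by
        rw [Nat.cast_pow] at hv'
        exact v'.isPrime.mem_of_pow_mem _ hv'
      apply (Rat.HeightOneSpectrum.primesEquiv (R := 𝓞 ℚ)).injective
      exact Subtype.ext ((Rat.HeightOneSpectrum.primesEquiv_eq_of_natCast_mem v' hp.out hv'p).trans
        (Rat.HeightOneSpectrum.primesEquiv_eq_of_natCast_mem v hp.out hv).symm)
    have h := prod_natCard_integer_quotient_natCast (K := ℚ) (pow_ne_zero m hp.out.ne_zero) hT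
    rw [Finset.prod_singleton, Module.finrank_self, pow_one] at h
    exact h
  rw [hOm] at hEPZ
  -- BRICKS D, D2 and the Frobenius count: `#H²(H_n, Z) ≤ #SF`
  have hH2 : Nat.card (continuousCohomology 2 (ρC.restrict (subgroupIncl Hn)).toTopRep) ≤ SF.card := by
    -- the Frobenius count (before any `CharZero ℚ_v` enters the context: `Algebra ℚ ℚ_v` diamond)
    have hcnt := @WeierstrassCurve.card_filter_smul_nsmul_eq_le ℚ _ W _ K _ _
      (charZero_of_injective_algebraMap (algebraMap ℚ K).injective) p _ B _ red₀ τ hτfix hgenr hsurj SF hSF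
      k Pk hPk0 hPkord
    haveI : CharZero K := charZero_of_injective_algebraMap (algebraMap ℚ K).injective
    obtain ⟨-, hD1⟩ := finite_and_natCard_two_restrict_le K Hn hopen ρC (p := p) (k := k) hZ2k
    -- `τ P_k = b P_k`
    obtain ⟨b, hb⟩ := hPkgen (τ • Pk) (hstab τ Pk hPk0)
      (by rw [natCast_zsmul, smul_comm, hPk2, smul_zero])
    have hb' : ρC τ Pz = b • Pz := Subtype.ext (by rw [hρC, AddSubmonoidClass.coe_nsmul]; exact hb)
    have hτω : ∀ z : MuCarrier K (p ^ k), mu K (p ^ k) τ z = z := by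
      intro z
      have hu1 : (((MuCarrier.toAdditive z).toMul : (AlgebraicClosure K)ˣ) : AlgebraicClosure K) ^ p ^ k = 1 := by
        have h' := ((MuCarrier.toAdditive z).toMul).2
        rw [mem_rootsOfUnity] at h'
        rw [← Units.val_pow_eq_pow_val, h', Units.val_one]
      apply MuCarrier.toAdditive.injective
      rw [mu_apply_apply]
      refine congrArg Additive.ofMul (Subtype.ext (Units.ext ?_))
      rw [absoluteGaloisGroup.coe_smul_rootsOfUnity, Units.coe_smul]
      exact hτfix k _ hu1
    haveI : NeZero (p ^ k) := ⟨pow_ne_zero k hp.out.ne_zero⟩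
    have hD2 := natCard_equivariant_le_card_filter Hn ρC (mu K (p ^ k)) (muEquivZMod K (p ^ k)) hPzord hZgen
      (hHile hτHi) hτω hb'
    refine hD1.trans (hD2.trans (le_trans (Finset.card_le_card fun i hi ↦ ?_) hcnt))
    simp only [Finset.mem_filter] at hi ⊢
    refine ⟨hi.1, ?_⟩
    have h := congrArg (fun z : Zs ↦ (z : P)) hi.2
    simp only [hρC, AddSubmonoidClass.coe_nsmul] at h
    exact h
  -- invariants of `Z` over `H_n` = `Aₙ[2^k]`
  have hinv : Nat.card (ρC.restrict (subgroupIncl Hn)).toTopRep.ρ.invariants =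
      Nat.card (nsmulAddMonoidHom (p ^ k) : Aₙ →+ Aₙ).ker := by
    refine Nat.card_congr ?_
    exact
      { toFun := fun z ↦ ⟨⟨((z.1 : Zs) : P), (hAₙ _).mpr ⟨(AddMonoidHom.mem_ker).mpr ((hZs _).mp z.1.2).1,
            fun σ hσ ↦ by
              have h := z.2 ⟨σ, hσ⟩
              exact (congrArg (fun y : Zs ↦ (y : P)) h : _)⟩⟩,
          by
            rw [AddMonoidHom.mem_ker, nsmulAddMonoidHom_apply]
            exact Subtype.ext (by rw [AddSubmonoidClass.coe_nsmul, ZeroMemClass.coe_zero]; exact ((hZs _).mp z.1.2).2)⟩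
        invFun := fun a ↦ ⟨⟨((a.1 : Aₙ) : P), (hZs _).mpr ⟨(AddMonoidHom.mem_ker).mp ((hAₙ _).mp a.1.2).1, by
            have h := a.2
            rw [AddMonoidHom.mem_ker, nsmulAddMonoidHom_apply] at h
            have h' := congrArg (fun y : Aₙ ↦ (y : P)) h
            simpa only [AddSubmonoidClass.coe_nsmul, ZeroMemClass.coe_zero] using h'⟩⟩,
          fun σ ↦ Subtype.ext (((hAₙ _).mp a.1.2).2 σ σ.2)⟩
        left_inv := fun z ↦ Subtype.ext (Subtype.ext rfl)
        right_inv := fun a ↦ Subtype.ext (Subtype.ext rfl) }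
  -- BRICK E with G6c: Lutz at depth `2^k` for `Aₙ`
  haveI := MultTowerNS2.finiteDimensional_fixedField_localSubgroup_layerSubgroup (κ := κ) v n
  have hfr := MultTowerNS2.finrank_fixedField_localSubgroup_layerSubgroup hκ v hv n
  have hAH : ∀ Q : P, Q ∈ Aₙ ↔ (Q : (W.baseChange (AlgebraicClosure K)).toAffine.Point) ∈
      kernel w (W.baseChange (AlgebraicClosure K)) ∧ ∀ σ ∈ Hn, σ • Q = Q := fun Q ↦ by
    rw [hAₙ, AddMonoidHom.mem_ker, hker Q]
  obtain ⟨hfinq, hfinker, hLutz⟩ := natCard_quotient_nsmul_fixedKernel_eq (K := ℚ) (v := v) hw hv W Hn Aₙ hAH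
  haveI := hfinq
  have hO2 : Nat.card (v.adicCompletionIntegers ℚ ⧸ Ideal.span {((p : ℕ) : v.adicCompletionIntegers ℚ)}) = p := by
    have hϖ : Irreducible ((p : ℕ) : v.adicCompletionIntegers ℚ) := irreducible_natCast_adicCompletionIntegers_rat hv
    rw [← (IsDiscreteValuationRing.irreducible_iff_uniformizer _).mp hϖ]
    change Nat.card (IsLocalRing.ResidueField (v.adicCompletionIntegers ℚ)) = p
    rw [natCard_residueField_adicCompletionIntegers v, Rat.HeightOneSpectrum.primesEquiv_eq_of_natCast_mem v hp.out hv]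
  have hfinj : ∀ j : ℕ, Finite (nsmulAddMonoidHom (p ^ j) : Aₙ →+ Aₙ).ker := by
    intro j
    obtain ⟨Pj, hPj0, hPjord, hPjgen⟩ := hgenr j
    haveI : Finite (AddSubgroup.zmultiples Pj) := Nat.finite_of_card_ne_zero (by
      rw [Nat.card_zmultiples, hPjord]; exact pow_ne_zero j hp.out.ne_zero)
    refine Finite.of_injective (fun a : (nsmulAddMonoidHom (p ^ j) : Aₙ →+ Aₙ).ker ↦
      (⟨((a : Aₙ) : P), ?_⟩ : AddSubgroup.zmultiples Pj)) fun a b hab ↦ ?_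
    · have ha := a.2
      rw [AddMonoidHom.mem_ker, nsmulAddMonoidHom_apply] at ha
      have ha' : p ^ j • ((a : Aₙ) : P) = 0 := by
        have h := congrArg (fun y : Aₙ ↦ (y : P)) ha
        simpa only [AddSubmonoidClass.coe_nsmul, ZeroMemClass.coe_zero] using h
      obtain ⟨c, hc⟩ := hPjgen _ ((AddMonoidHom.mem_ker).mp ((hAₙ _).mp (a : Aₙ).2).1)
        (by rw [natCast_zsmul]; exact ha')
      rw [hc]
      exact AddSubgroup.nsmul_mem _ (AddSubgroup.mem_zmultiples Pj) c
    · exact Subtype.ext (Subtype.ext (congrArg (fun y : AddSubgroup.zmultiples Pj ↦ (y : P)) hab))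
  obtain ⟨hfinqk, hE⟩ := natCard_quotient_nsmul_pow_eq (A := Aₙ) p _ hfinj hLutz k
  rw [hO2, hfr] at hE
  -- a finite level fixing the `H_∞`-fixed part of `Z`
  have hlev : ∀ z : Zs, (∀ h ∈ Hi, h • (z : P) = z) →
      ∃ m : ℕ, ∀ h ∈ localSubgroup (κ.layerSubgroup m) K, h • (z : P) = z := fun z hz ↦
    exists_forall_mem_localSubgroup_layerSubgroup_smul_point_eq (κ := κ) v W (z : P) hz
  letI : Fintype Zs := Fintype.ofFinite Zs
  let mfun : Zs → ℕ := fun z ↦ if hz : (∀ h ∈ Hi, h • (z : P) = z) then (hlev z hz).choose else 0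
  let m₀ : ℕ := Finset.univ.sup mfun
  have hZlev : ∀ a ∈ red₀.ker, p ^ k • a = 0 → (∀ h ∈ Hi, h • a = a) →
      ∀ h ∈ localSubgroup (κ.layerSubgroup m₀) K, h • a = a := by
    intro a ha hak hai h hh
    have haZ : a ∈ Zs := (hZs a).mpr ⟨(AddMonoidHom.mem_ker).mp ha, hak⟩
    have hspec := (hlev ⟨a, haZ⟩ hai).choose_spec
    have hle : mfun ⟨a, haZ⟩ ≤ m₀ := Finset.le_sup (f := mfun) (Finset.mem_univ _)
    have hm : mfun ⟨a, haZ⟩ = (hlev ⟨a, haZ⟩ hai).choose := dif_pos hai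
    rw [hm] at hle
    exact hspec h (MultTowerSP1.localSubgroup_layerSubgroup_antitone κ K hle hh)
  -- `H¹(H_n, Z)` in the currency of BRICK B (the discrete module `Z`) is `H¹` of `ρC|_{H_n}`
  let X₁ : TopRep ℤ Hn := discreteTopRep Hn Zs
  let X₂ : TopRep ℤ Hn := (ρC.restrict (subgroupIncl Hn)).toTopRep
  let e : Hn ≃ₜ* Hn := ContinuousMulEquiv.refl Hn
  let φ : TopRep.res ((e.symm : Hn →ₜ* Hn) : Hn →* Hn) X₁ ⟶ X₂ := TopRep.ofHom ⟨ContinuousLinearMap.id ℤ Zs, fun _ ↦ rfl⟩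
  let ψ : TopRep.res ((e : Hn →ₜ* Hn) : Hn →* Hn) X₂ ⟶ X₁ := TopRep.ofHom ⟨ContinuousLinearMap.id ℤ Zs, fun _ ↦ rfl⟩
  have htr : Nat.card (discreteH1 Hn Zs) = Nat.card (continuousCohomology 1 X₂) :=
    natCard_continuousCohomology_eq_of_continuousMulEquiv e φ ψ (fun _ ↦ rfl) (fun _ ↦ rfl) 1
  haveI : Finite (discreteH1 Hn Zs) := finite_continuousCohomology_of_continuousMulEquiv e φ ψ (fun _ ↦ rfl) 1
  -- BRICK B2′: the Kummer count at depth `2^k`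
  have hZr : ∀ a : P, a ∈ red₀.ker ∧ p ^ k • a = 0 ↔ a ∈ Zs.subtype.range := fun a ↦ by
    rw [AddSubgroup.range_subtype, hZs, AddMonoidHom.mem_ker]
  obtain ⟨hfinT, -, hB⟩ := natCard_torsionBy_coinv_mul_card_quotient_le_card_H1_of_fixed hκ v hv W n k m₀ hg hgen
    red₀.ker hkst (hdivpow k) hZlev Zs.subtype Subtype.val_injective hZr (fun _ _ ↦ rfl) M₁ hM₁ D₁ hD₁ Aₙ hAₙ
  refine ⟨hfinT, ?_⟩
  -- combine
  rw [htr] at hB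
  rw [hinv] at hEPZ
  haveI := hfinker
  haveI := hfinj k
  have hppos : 0 < p := hp.out.pos
  have hX : 0 < (p ^ p ^ n) ^ k * Nat.card (nsmulAddMonoidHom (p ^ k) : Aₙ →+ Aₙ).ker :=
    Nat.mul_pos (by positivity) Nat.card_pos
  have hpm : p ^ m ≤ (p ^ p ^ n) ^ k := by rw [← pow_mul, mul_comm]; exact hmle
  refine Nat.le_of_mul_le_mul_right ?_ hX
  calc Nat.card {c : M₁ ⧸ D₁.range // p ^ k • c = 0} * ((p ^ p ^ n) ^ k * Nat.card (nsmulAddMonoidHom (p ^ k) : Aₙ →+ Aₙ).ker)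
      = Nat.card {c : M₁ ⧸ D₁.range // p ^ k • c = 0} * Nat.card (Aₙ ⧸ (nsmulAddMonoidHom (p ^ k) : Aₙ →+ Aₙ).range) := by
        rw [hE]
    _ ≤ Nat.card (continuousCohomology 1 X₂) := hB
    _ = Nat.card (nsmulAddMonoidHom (p ^ k) : Aₙ →+ Aₙ).ker *
          Nat.card (continuousCohomology 2 (ρC.restrict (subgroupIncl Hn)).toTopRep) * p ^ m := hEPZ
    _ ≤ Nat.card (nsmulAddMonoidHom (p ^ k) : Aₙ →+ Aₙ).ker * SF.card * (p ^ p ^ n) ^ k :=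
        Nat.mul_le_mul (Nat.mul_le_mul_left _ hH2) hpm
    _ = SF.card * ((p ^ p ^ n) ^ k * Nat.card (nsmulAddMonoidHom (p ^ k) : Aₙ →+ Aₙ).ker) := by ring

end Summit.BirchSwinnertonDyer.BirchSwinnertonDyer.Theorems.GoodOrdTower

end
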